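import Summits.MatrixMultiplication.OmegaCensus.DicyclicParityTools
import Summits.MatrixMultiplication.OmegaCensus.DicyclicSubgroupRestriction
import Summits.MatrixMultiplication.OmegaCensus.CubeLawParityRank
import HarnessLib

/-!
# Class N2 (`(1,1),(a,a+1),(4,4)`) of the dicyclic-law triples is dead for EVERY quotient `A/⟨c₀⟩` of `2`-rank `≥ 3`

ω-census `pub-omega`, family (b3), seat pub-omega-group gen 13.  Framing: lottery ticket; floor = certified bounds/negative
ranges.  VALUE: kernel theorems about the group-theoretic method (TPP capacity of dihedral-like groups); NOT progress on ω.

Gen 12 (`DicyclicN2Stable.no_n2_dicyclic_law`) killed the class N2 when `A/⟨c₀⟩` is a `2`-GROUP (odd-weight transfer in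
`𝔽₂[A/⟨c₀⟩]`).  Here the `2`-group hypothesis is removed: only `c₀ ≠ 0`, `|A| ≡ 2 (mod 3)`, `|A| ≥ 28` and three
homomorphisms `ψ₁, ψ₂, ψ₃ : A →+ ZMod 2` killing `c₀`, jointly onto `V = 𝔽₂³`, are assumed — so the census families
`C₂² × Q_{4m}` (`m ≡ 4 (mod 6)`), `C₂³ × Q_{4m}` (`m ≡ 2 (mod 3)`), `C₂² × (ℤ_n ⋊ ℤ₄)` (`n ≡ 4 (mod 6)`) are covered for ALL
`m, n`, not only the `2`-powers.

**Theorem (`no_n2_dicyclic_law_general`).** No TPP triple with `|S₀| = |S₁| = 1`, `|U₀| = |U₁| = 4` attains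
`3|S||T||U| + 16 = 8|A|`.

*Proof.* As in gen 12, `{|T₀|, |T₁|} = {a, a+1}` with `a` even, and after a `τ0`-translation `|T₁|` is odd and the vertex
`111` is exact: `A = (S₀+T₁+U₁) ⊔ (S₁+T₀+U₁) ⊔ (S₁+T₁+U₀)` with the boxes `c₀`-periodic.  (1) Unit trick over
`Ψ = (ψ₁,ψ₂,ψ₃) : A → V` (a `2`-group!): the periodic injective box `{s₁} + T₁ + U₀` with `|T₁|` odd has all `Ψ`-fibre counts
of `U₀` even (`even_fibres_of_periodic_box_odd`, the gen-12 transfer `even_of_odd_weight_convolution` with target `V`); same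
for `U₁`.  A `4`-set with even fibre counts meets one fibre (`4`) or two fibres (`2+2`): `Ψ(U_l − U_l) ⊆ {0, v_l}`
(`fibre_pair_structure`).  (2) Real-character parity (cf. `CubeLawParity`): for `χ = (−1)^{ω∘Ψ}` the tiling gives
`χ(s₀)χ(T₁)χ(U₁) + χ(s₁)χ(T₀)χ(U₁) + χ(s₁)χ(T₁)χ(U₀) = 0` with `χ(T₁)` odd, `χ(T₀)` even, `χ(U_l) ∈ {0, ±4}` and
`χ(U_l) = 0 ⟺ ω(v_l) ≠ 0`; choosing `ω` with `ω(v₁) ≠ 0 = ω(v₀)` (or vice versa) gives a contradiction, so `v₀ = v₁ = v`.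
(3) A non-zero `ω` with `ω(v) = 0 = ω(Ψδ)`, `δ = (u₁ − u₀) − (s₁ − s₀)`, exists in dimension `3`; then `φ = ω ∘ Ψ` is constant
on each coset part of `S` and `U` with the right cross condition, and `no_dicyclic_law_of_two_small` (restriction to the
index-`2` subgroup `ρ(ker φ) ∪ τ(x + ker φ)`, gen 13) finishes.  ∎
-/

namespace Summit.MatrixMultiplication.OmegaCensus

open Literature.Combinatorics.Additive Finset

/-! ## Class N2 for every quotient of `2`-rank `≥ 3` -/

section N2

variable {A : Type} [AddCommGroup A] [DecidableEq A] [Fintype A] {G : Type} [Group G] [DecidableEq G]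
  {ρ τ : A → G} {c₀ : A}

/-- **Normalised N2 contradiction** (see the module docstring): dicyclic type, `|A| ≡ 2 (mod 3)`, `|A| ≥ 28`,
`A/⟨c₀⟩ ↠ 𝔽₂³`; a TPP triple attaining the dicyclic law with `|S₀| = |S₁| = 1`, `|T₁|` odd, `|T₀|` even,
`|U₀| = |U₁| = 4` and the vertex `111` exact.  Then `False`. [folklore] -/
theorem n2_general_aux
    (hρρ : ∀ a b, ρ a * ρ b = ρ (a + b)) (hρτ : ∀ a b, ρ a * τ b = τ (b - a))
    (hτρ : ∀ a b, τ a * ρ b = τ (a + b)) (hττ : ∀ a b, τ a * τ b = ρ (c₀ + b - a)) (hc₀ : c₀ ≠ 0)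
    (hρ : Function.Injective ρ) (hτ : Function.Injective τ) (hne : ∀ a b, ρ a ≠ τ b)
    (hsurj : ∀ g, (∃ a, ρ a = g) ∨ (∃ a, τ a = g)) (hmod : Fintype.card A % 3 = 2) (hA : 28 ≤ Fintype.card A)
    (ψ₁ ψ₂ ψ₃ : A →+ ZMod 2) (hψc : ψ₁ c₀ = 0 ∧ ψ₂ c₀ = 0 ∧ ψ₃ c₀ = 0)
    (hψ : ∀ v : ZMod 2 × ZMod 2 × ZMod 2, ∃ y, (ψ₁ y, ψ₂ y, ψ₃ y) = v)
    {S T U : Finset G} (h : TripleProductProperty S T U)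
    (hV : 3 * (S.card * T.card * U.card) + 16 = 8 * Fintype.card A)
    (hs₀ : (univ.filter fun a : A => ρ a ∈ S).card = 1) (hs₁ : (univ.filter fun a : A => τ a ∈ S).card = 1)
    (hodd : Odd (univ.filter fun a : A => τ a ∈ T).card) (heven : Even (univ.filter fun a : A => ρ a ∈ T).card)
    (hu₀ : (univ.filter fun a : A => ρ a ∈ U).card = 4) (hu₁ : (univ.filter fun a : A => τ a ∈ U).card = 4)
    (hex : (univ.filter fun a : A => τ a ∈ T).card * (univ.filter fun a : A => τ a ∈ U).card +
      (univ.filter fun a : A => ρ a ∈ T).card * (univ.filter fun a : A => τ a ∈ U).card +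
      (univ.filter fun a : A => τ a ∈ T).card * (univ.filter fun a : A => ρ a ∈ U).card = Fintype.card A) :
    False := by
  classical
  set S₀ : Finset A := univ.filter fun a => ρ a ∈ S with hS₀
  set S₁ : Finset A := univ.filter fun a => τ a ∈ S with hS₁
  set T₀ : Finset A := univ.filter fun a => ρ a ∈ T with hT₀
  set T₁ : Finset A := univ.filter fun a => τ a ∈ T with hT₁
  set U₀ : Finset A := univ.filter fun a => ρ a ∈ U with hU₀
  set U₁ : Finset A := univ.filter fun a => τ a ∈ U with hU₁
  have h2c := two_c0_eq_zero hρτ hτρ hττ hτ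
  have mS₀ : ∀ a ∈ S₀, cond false (τ a) (ρ a) ∈ S := fun a ha => by simpa [hS₀] using ha
  have mS₁ : ∀ a ∈ S₁, cond true (τ a) (ρ a) ∈ S := fun a ha => by simpa [hS₁] using ha
  have mT₀ : ∀ a ∈ T₀, cond false (τ a) (ρ a) ∈ T := fun a ha => by simpa [hT₀] using ha
  have mT₁ : ∀ a ∈ T₁, cond true (τ a) (ρ a) ∈ T := fun a ha => by simpa [hT₁] using ha
  have mU₀ : ∀ a ∈ U₀, cond false (τ a) (ρ a) ∈ U := fun a ha => by simpa [hU₀] using ha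
  have mU₁ : ∀ a ∈ U₁, cond true (τ a) (ρ a) ∈ U := fun a ha => by simpa [hU₁] using ha
  have cs := card_sumset' hρρ hττ hρ hτ h
  have inj := sum_injOn' hρρ hττ hρ hτ h
  -- the vertex `111`: boxes `B011 = S₀+T₁+U₁`, `B101 = S₁+T₀+U₁`, `B110 = S₁+T₁+U₀`
  set B011 := (S₀ ×ˢ T₁ ×ˢ U₁).image fun p : A × A × A => p.1 + p.2.1 + p.2.2 with hB011
  set B101 := (S₁ ×ˢ T₀ ×ˢ U₁).image fun p : A × A × A => p.1 + p.2.1 + p.2.2 with hB101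
  set B110 := (S₁ ×ˢ T₁ ×ˢ U₀).image fun p : A × A × A => p.1 + p.2.1 + p.2.2 with hB110
  have d₁ : Disjoint B101 B011 := (disjoint_sumset₁' hρρ hρτ hτρ hττ hne h) true mS₁ mT₀ mU₁ mS₀ mT₁
  have d₂ : Disjoint B110 B101 := (disjoint_sumset₂' hρρ hρτ hτρ hττ hne h) true mS₁ mT₁ mU₀ mS₁ mT₀ mU₁
  have d₃ : Disjoint B011 B110 := (disjoint_sumset₃' hρρ hρτ hτρ hττ hne h) true mS₀ mT₁ mU₁ mS₁ mU₀
  have sh₁ : Disjoint B101 (B011.image (· + c₀)) :=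
    (disjoint_sumset₁_shift' hρρ hρτ hττ hne h) true mS₁ mT₀ mU₁ mS₀ mT₁
  have sh₂ : Disjoint (B101.image (· + c₀)) B110 :=
    (disjoint_sumset₂_shift' hρρ hρτ hττ hne h) true mS₁ mT₀ mU₁ mS₁ mT₁ mU₀
  have sh₃ : Disjoint B110 (B011.image (· + c₀)) :=
    (disjoint_sumset₃_shift' hρρ hρτ hτρ hττ hne h) true mS₁ mT₁ mU₀ mS₀ mU₁
  have c011 : B011.card = T₁.card * U₁.card := by rw [hB011, cs false true true mS₀ mT₁ mU₁, hs₀, one_mul]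
  have c101 : B101.card = T₀.card * U₁.card := by rw [hB101, cs true false true mS₁ mT₀ mU₁, hs₁, one_mul]
  have c110 : B110.card = T₁.card * U₀.card := by rw [hB110, cs true true false mS₁ mT₁ mU₀, hs₁, one_mul]
  have hcard : B011.card + B101.card + B110.card = Fintype.card A := by rw [c011, c101, c110, ← hex]
  have hper011 : B011.image (· + c₀) = B011 :=
    periodic_of_exact_vertex d₁.symm d₃ d₂.symm hcard sh₁.symm sh₃.symm
  have hper110 : B110.image (· + c₀) = B110 :=
    periodic_of_exact_vertex d₃.symm d₂ (by exact d₁.symm) (by rw [← hcard]; ring)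
      (disjoint_image_add_comm h2c sh₃) (disjoint_image_add_comm h2c (by exact sh₂.symm))
  have hunion : B011 ∪ B101 ∪ B110 = univ := by
    apply eq_univ_of_card
    rw [card_union_of_disjoint (disjoint_union_left.2 ⟨d₃, d₂.symm⟩), card_union_of_disjoint d₁.symm]
    exact hcard
  -- `S₀ = {s₀}`, `S₁ = {s₁}`; base points of `U₀`, `U₁`
  obtain ⟨s₀, hS₀eq⟩ := card_eq_one.1 hs₀
  obtain ⟨s₁, hS₁eq⟩ := card_eq_one.1 hs₁
  obtain ⟨u₀, hu₀m⟩ : U₀.Nonempty := card_pos.1 (by rw [hu₀]; norm_num)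
  obtain ⟨u₁, hu₁m⟩ : U₁.Nonempty := card_pos.1 (by rw [hu₁]; norm_num)
  -- the map `Ψ : A → V = 𝔽₂³`
  let Ψ : A →+ ZMod 2 × ZMod 2 × ZMod 2 := ψ₁.prod (ψ₂.prod ψ₃)
  have hΨ : ∀ a, Ψ a = (ψ₁ a, ψ₂ a, ψ₃ a) := fun a => rfl
  have hΨc : Ψ c₀ = 0 := by rw [hΨ, hψc.1, hψc.2.1, hψc.2.2]; rfl
  have hΨsurj : Function.Surjective Ψ := fun v => by
    obtain ⟨a, ha⟩ := hψ v
    exact ⟨a, by rw [hΨ]; exact ha⟩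
  -- (1) even `Ψ`-fibres of `U₀` (box `{s₁}+T₁+U₀`) and `U₁` (box `{s₀}+T₁+U₁`)
  have hevU₀ : ∀ z, 2 ∣ (U₀.filter fun u => Ψ u = z).card := by
    have hinj : Set.InjOn (fun p : A × A × A => p.1 + p.2.1 + p.2.2) ↑(({s₁} : Finset A) ×ˢ T₁ ×ˢ U₀) := by
      rw [← hS₁eq]; exact inj true true false mS₁ mT₁ mU₀
    have hper : (((({s₁} : Finset A) ×ˢ T₁ ×ˢ U₀).image fun p : A × A × A => p.1 + p.2.1 + p.2.2).image
        (· + c₀)) = (({s₁} : Finset A) ×ˢ T₁ ×ˢ U₀).image fun p : A × A × A => p.1 + p.2.1 + p.2.2 := by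
      rw [← hS₁eq]; exact hper110
    exact even_fibres_of_periodic_box_odd Ψ hΨc hc₀ h2c f2cube_two_nsmul hodd hinj hper
  have hevU₁ : ∀ z, 2 ∣ (U₁.filter fun u => Ψ u = z).card := by
    have hinj : Set.InjOn (fun p : A × A × A => p.1 + p.2.1 + p.2.2) ↑(({s₀} : Finset A) ×ˢ T₁ ×ˢ U₁) := by
      rw [← hS₀eq]; exact inj false true true mS₀ mT₁ mU₁
    have hper : (((({s₀} : Finset A) ×ˢ T₁ ×ˢ U₁).image fun p : A × A × A => p.1 + p.2.1 + p.2.2).image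
        (· + c₀)) = (({s₀} : Finset A) ×ˢ T₁ ×ˢ U₁).image fun p : A × A × A => p.1 + p.2.1 + p.2.2 := by
      rw [← hS₀eq]; exact hper011
    exact even_fibres_of_periodic_box_odd Ψ hΨc hc₀ h2c f2cube_two_nsmul hodd hinj hper
  obtain ⟨v₀, hv₀c, hv₀ne, hv₀z⟩ := fibre_pair_structure Ψ hu₀ hevU₀
  obtain ⟨v₁, hv₁c, hv₁ne, hv₁z⟩ := fibre_pair_structure Ψ hu₁ hevU₁
  -- (2) real-character parity on the tiling `A = B011 ⊔ B101 ⊔ B110`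
  have key : ∀ ω : (ZMod 2 × ZMod 2 × ZMod 2) →+ ZMod 2, (∃ a, ω (Ψ a) ≠ 0) →
      (if ω (Ψ s₀) = 0 then (1 : ℤ) else -1) * (∑ a ∈ T₁, (if ω (Ψ a) = 0 then (1 : ℤ) else -1)) *
          (∑ a ∈ U₁, (if ω (Ψ a) = 0 then (1 : ℤ) else -1)) +
        (if ω (Ψ s₁) = 0 then (1 : ℤ) else -1) * (∑ a ∈ T₀, (if ω (Ψ a) = 0 then (1 : ℤ) else -1)) *
          (∑ a ∈ U₁, (if ω (Ψ a) = 0 then (1 : ℤ) else -1)) +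
        (if ω (Ψ s₁) = 0 then (1 : ℤ) else -1) * (∑ a ∈ T₁, (if ω (Ψ a) = 0 then (1 : ℤ) else -1)) *
          (∑ a ∈ U₀, (if ω (Ψ a) = 0 then (1 : ℤ) else -1)) = 0 := by
    intro ω hω
    set φ : A →+ ZMod 2 := ω.comp Ψ with hφ
    have hφa : ∀ a, φ a = ω (Ψ a) := fun a => rfl
    have hmul := homSgn_mul φ
    have hsum := homSgn_sum φ (by obtain ⟨a, ha⟩ := hω; exact ⟨a, by rw [hφa]; exact ha⟩)
    have e011 := realChar_sumset (χ := fun a => if φ a = 0 then (1 : ℤ) else -1) hmul (inj false true true mS₀ mT₁ mU₁)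
    have e101 := realChar_sumset (χ := fun a => if φ a = 0 then (1 : ℤ) else -1) hmul (inj true false true mS₁ mT₀ mU₁)
    have e110 := realChar_sumset (χ := fun a => if φ a = 0 then (1 : ℤ) else -1) hmul (inj true true false mS₁ mT₁ mU₀)
    have htot : (∑ a, (fun a => if φ a = 0 then (1 : ℤ) else -1) a) =
        (∑ x ∈ B011, (fun a => if φ a = 0 then (1 : ℤ) else -1) x) +
        (∑ x ∈ B101, (fun a => if φ a = 0 then (1 : ℤ) else -1) x) +
        (∑ x ∈ B110, (fun a => if φ a = 0 then (1 : ℤ) else -1) x) := by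
      rw [← hunion, sum_union (disjoint_union_left.2 ⟨d₃, d₂.symm⟩), sum_union d₁.symm]
    rw [hsum, hB011, hB101, hB110, e011, e101, e110, hS₀eq, hS₁eq, sum_singleton, sum_singleton] at htot
    simp only [hφa] at htot
    linarith
  -- parities of the sign sums
  have parT₁ : ∀ ω : (ZMod 2 × ZMod 2 × ZMod 2) →+ ZMod 2,
      ∃ m : ℤ, (∑ a ∈ T₁, (if ω (Ψ a) = 0 then (1 : ℤ) else -1)) = 2 * m + 1 := by
    intro ω
    have := sgnSum_eq_card_sub (ω.comp Ψ) T₁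
    simp only [AddMonoidHom.coe_comp, Function.comp_apply] at this
    obtain ⟨k, hk⟩ := hodd
    refine ⟨(k : ℤ) - ((T₁.filter fun a => ω (Ψ a) ≠ 0).card : ℤ), ?_⟩
    rw [this, hk]; push_cast; ring
  have parT₀ : ∀ ω : (ZMod 2 × ZMod 2 × ZMod 2) →+ ZMod 2,
      ∃ m : ℤ, (∑ a ∈ T₀, (if ω (Ψ a) = 0 then (1 : ℤ) else -1)) = 2 * m := by
    intro ω
    have := sgnSum_eq_card_sub (ω.comp Ψ) T₀
    simp only [AddMonoidHom.coe_comp, Function.comp_apply] at this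
    obtain ⟨k, hk⟩ := heven
    refine ⟨(k : ℤ) - ((T₀.filter fun a => ω (Ψ a) ≠ 0).card : ℤ), ?_⟩
    rw [this, hk]; push_cast; ring
  have sgn_cases : ∀ z : ZMod 2, (if z = 0 then (1 : ℤ) else -1) = 1 ∨ (if z = 0 then (1 : ℤ) else -1) = -1 := by
    intro z; split_ifs; exacts [Or.inl rfl, Or.inr rfl]
  -- no `ω` separates `v₁` from `v₀` …
  have nosep₁ : ∀ ω : (ZMod 2 × ZMod 2 × ZMod 2) →+ ZMod 2, ¬ (ω v₁ ≠ 0 ∧ ω v₀ = 0) := by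
    rintro ω ⟨h1, h0⟩
    have hω : ∃ a, ω (Ψ a) ≠ 0 := by obtain ⟨a, ha⟩ := hΨsurj v₁; exact ⟨a, by rw [ha]; exact h1⟩
    have E := key ω hω
    rw [hv₁z ω h1] at E
    have hU₀ne := hv₀ne ω h0
    obtain ⟨m, hm⟩ := parT₁ ω
    rw [hm] at E
    rcases sgn_cases (ω (Ψ s₁)) with e | e <;> rw [e] at E
    · have : (2 * m + 1) * (∑ a ∈ U₀, (if ω (Ψ a) = 0 then (1 : ℤ) else -1)) = 0 := by linarith
      rcases mul_eq_zero.1 this with h' | h'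
      · omega
      · exact hU₀ne h'
    · have : (2 * m + 1) * (∑ a ∈ U₀, (if ω (Ψ a) = 0 then (1 : ℤ) else -1)) = 0 := by linarith
      rcases mul_eq_zero.1 this with h' | h'
      · omega
      · exact hU₀ne h'
  -- … nor `v₀` from `v₁`
  have nosep₀ : ∀ ω : (ZMod 2 × ZMod 2 × ZMod 2) →+ ZMod 2, ¬ (ω v₀ ≠ 0 ∧ ω v₁ = 0) := by
    rintro ω ⟨h0, h1⟩
    have hω : ∃ a, ω (Ψ a) ≠ 0 := by obtain ⟨a, ha⟩ := hΨsurj v₀; exact ⟨a, by rw [ha]; exact h0⟩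
    have E := key ω hω
    rw [hv₀z ω h0] at E
    have hU₁ne := hv₁ne ω h1
    obtain ⟨m₁, hm₁⟩ := parT₁ ω
    obtain ⟨m₀, hm₀⟩ := parT₀ ω
    rw [hm₁, hm₀] at E
    have E' : ((if ω (Ψ s₀) = 0 then (1 : ℤ) else -1) * (2 * m₁ + 1) +
        (if ω (Ψ s₁) = 0 then (1 : ℤ) else -1) * (2 * m₀)) *
        (∑ a ∈ U₁, (if ω (Ψ a) = 0 then (1 : ℤ) else -1)) = 0 := by linarith
    rcases mul_eq_zero.1 E' with h' | h'
    · rcases sgn_cases (ω (Ψ s₀)) with e | e <;> rcases sgn_cases (ω (Ψ s₁)) with e' | e' <;>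
        rw [e, e'] at h' <;> omega
    · exact hU₁ne h'
  -- (3) the subgroup restriction: `ω ≠ 0` with `ω v₀ = 0 = ω (Ψ δ)`
  set δ : A := u₁ - u₀ - (s₁ - s₀) with hδ
  obtain ⟨w, hw0, hwv, hwd⟩ := f2cube_exists_perp₂ v₀ (Ψ δ)
  let σ : (ZMod 2 × ZMod 2 × ZMod 2) →+ ZMod 2 :=
    (AddMonoidHom.fst (ZMod 2) (ZMod 2 × ZMod 2)) + (AddMonoidHom.fst (ZMod 2) (ZMod 2)).comp
      (AddMonoidHom.snd (ZMod 2) (ZMod 2 × ZMod 2)) + (AddMonoidHom.snd (ZMod 2) (ZMod 2)).comp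
      (AddMonoidHom.snd (ZMod 2) (ZMod 2 × ZMod 2))
  let ω : (ZMod 2 × ZMod 2 × ZMod 2) →+ ZMod 2 := σ.comp (AddMonoidHom.mulLeft w)
  have hωv : ∀ v, ω v = (w * v).1 + (w * v).2.1 + (w * v).2.2 := fun v => rfl
  have hω₀ : ω v₀ = 0 := by rw [hωv]; exact hwv
  have hωδ : ω (Ψ δ) = 0 := by rw [hωv]; exact hwd
  have hω₁ : ω v₁ = 0 := by
    by_contra h1
    exact nosep₁ ω ⟨h1, hω₀⟩
  set φ : A →+ ZMod 2 := ω.comp Ψ with hφdef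
  have hφa : ∀ a, φ a = ω (Ψ a) := fun a => rfl
  have hφc : φ c₀ = 0 := by rw [hφa, hΨc, map_zero]
  have hφ : ∃ a, φ a ≠ 0 := by
    obtain ⟨z, hz⟩ := f2cube_exists_pair_one' w hw0
    obtain ⟨a, ha⟩ := hΨsurj z
    exact ⟨a, by rw [hφa, ha, hωv]; exact hz⟩
  refine no_dicyclic_law_of_two_small hρρ hρτ hτρ hττ hc₀ hρ hτ hne hsurj hmod hA ψ₁ ψ₂ ψ₃ hψc hψ h hV φ hφc hφ
    (s₁ - s₀) (φ s₀) (φ u₀) ?_ ?_ ?_ ?_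
  · intro a ha
    have : a ∈ S₀ := mem_filter.2 ⟨mem_univ _, ha⟩
    rw [hS₀eq, mem_singleton] at this; rw [this]
  · intro a ha
    have : a ∈ S₁ := mem_filter.2 ⟨mem_univ _, ha⟩
    rw [hS₁eq, mem_singleton] at this
    rw [this, map_sub]; abel
  · intro a ha
    have haU : a ∈ U₀ := mem_filter.2 ⟨mem_univ _, ha⟩
    rw [hφa, hφa]
    exact hv₀c ω hω₀ a haU u₀ hu₀m
  · intro a ha
    have haU : a ∈ U₁ := mem_filter.2 ⟨mem_univ _, ha⟩
    have e1 : φ a = φ u₁ := by rw [hφa, hφa]; exact hv₁c ω hω₁ a haU u₁ hu₁m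
    have e2 : u₁ = δ + u₀ + (s₁ - s₀) := by rw [hδ]; abel
    rw [e1, e2, map_add, map_add, hφa δ, hωδ, zero_add]

/-- **No N2-class dicyclic-law triple for ANY `A/⟨c₀⟩` of `2`-rank `≥ 3`.**  Dicyclic type (`c₀ ≠ 0`), `|A| ≡ 2 (mod 3)`,
`|A| ≥ 28`, three homomorphisms `A →+ ZMod 2` killing `c₀` jointly onto `𝔽₂³` (no `2`-group hypothesis).  Then no TPP triple with
`|S₀| = |S₁| = 1` and `|U₀| = |U₁| = 4` attains `3|S||T||U| + 16 = 8|A|`.  (Reduction to `n2_general_aux` exactly as in gen 12's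
`no_n2_dicyclic_law`: `{|T₀|, |T₁|} = {a, a+1}`, `a` even, and a `τ0`-translation of `T` if `|T₀|` is the odd part.) [folklore] -/
theorem no_n2_dicyclic_law_general
    (hρρ : ∀ a b, ρ a * ρ b = ρ (a + b)) (hρτ : ∀ a b, ρ a * τ b = τ (b - a))
    (hτρ : ∀ a b, τ a * ρ b = τ (a + b)) (hττ : ∀ a b, τ a * τ b = ρ (c₀ + b - a)) (hc₀ : c₀ ≠ 0)
    (hρ : Function.Injective ρ) (hτ : Function.Injective τ) (hne : ∀ a b, ρ a ≠ τ b)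
    (hsurj : ∀ g, (∃ a, ρ a = g) ∨ (∃ a, τ a = g)) (hmod : Fintype.card A % 3 = 2) (hA : 28 ≤ Fintype.card A)
    (ψ₁ ψ₂ ψ₃ : A →+ ZMod 2) (hψc : ψ₁ c₀ = 0 ∧ ψ₂ c₀ = 0 ∧ ψ₃ c₀ = 0)
    (hψ : ∀ v : ZMod 2 × ZMod 2 × ZMod 2, ∃ x, (ψ₁ x, ψ₂ x, ψ₃ x) = v)
    {S T U : Finset G} (h : TripleProductProperty S T U)
    (hs₀ : (univ.filter fun a : A => ρ a ∈ S).card = 1) (hs₁ : (univ.filter fun a : A => τ a ∈ S).card = 1)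
    (hu₀ : (univ.filter fun a : A => ρ a ∈ U).card = 4) (hu₁ : (univ.filter fun a : A => τ a ∈ U).card = 4) :
    3 * (S.card * T.card * U.card) + 16 ≠ 8 * Fintype.card A := by
  intro hV
  have cS : S.card = 2 := by rw [card_eq_parts' hρ hτ hne hsurj S, hs₀, hs₁]
  have cU : U.card = 8 := by rw [card_eq_parts' hρ hτ hne hsurj U, hu₀, hu₁]
  have cT := card_eq_parts' hρ hτ hne hsurj T
  have h8 : 8 ∣ Fintype.card A := eight_dvd_card_of_onto ψ₁ ψ₂ ψ₃ hψ
  obtain ⟨h000, h111, -⟩ := vertex_counting' hρρ hρτ hτρ hττ hρ hτ hne h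
  rw [hs₀, hs₁, hu₀, hu₁] at h000 h111
  have hV' := hV
  rw [cS, cT, cU] at hV'
  set t₀ := (univ.filter fun a : A => ρ a ∈ T).card with ht₀
  set t₁ := (univ.filter fun a : A => τ a ∈ T).card with ht₁
  obtain ⟨q, hq⟩ := h8
  by_cases hcase : t₁ = t₀ + 1
  · have hodd : Odd t₁ := ⟨t₀ / 2, by omega⟩
    have heven : Even t₀ := ⟨t₀ / 2, by omega⟩
    exact n2_general_aux hρρ hρτ hτρ hττ hc₀ hρ hτ hne hsurj hmod hA ψ₁ ψ₂ ψ₃ hψc hψ h hV hs₀ hs₁ hodd heven hu₀ hu₁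
      (by rw [hu₀, hu₁]; omega)
  · have hcase' : t₀ = t₁ + 1 := by omega
    -- translate `T` by `τ0`: the parts swap
    have er : (Equiv.mulRight (1 : G)).toEmbedding = Function.Embedding.refl G := by ext x; simp
    have h' : TripleProductProperty S (T.map (Equiv.mulRight (τ 0)).toEmbedding) U := by
      have := h.map_mulRight 1 (τ 0) 1; simpa only [er, Finset.map_refl] using this
    have cT'₀ := card_rho_part_mulRight_tau hρρ hρτ hττ (A := A) T
    have cT'₁ := card_tau_part_mulRight_tau hρρ hττ (A := A) T
    have hodd : Odd (univ.filter fun a : A => τ a ∈ T.map (Equiv.mulRight (τ 0)).toEmbedding).card := by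
      rw [cT'₁]; exact ⟨t₁ / 2, by omega⟩
    have heven : Even (univ.filter fun a : A => ρ a ∈ T.map (Equiv.mulRight (τ 0)).toEmbedding).card := by
      rw [cT'₀]; exact ⟨t₁ / 2, by omega⟩
    have hVmap : 3 * (S.card * (T.map (Equiv.mulRight (τ 0)).toEmbedding).card * U.card) + 16 = 8 * Fintype.card A := by
      rw [card_map]; exact hV
    exact n2_general_aux hρρ hρτ hτρ hττ hc₀ hρ hτ hne hsurj hmod hA ψ₁ ψ₂ ψ₃ hψc hψ h' hVmap hs₀ hs₁ hodd heven hu₀ hu₁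
      (by rw [cT'₀, cT'₁, hu₀, hu₁]; omega)

end N2

end Summit.MatrixMultiplication.OmegaCensus
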